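import Literature.AnabelianGeometry.EtaleTheta.Discharge.Sec2DiscreteRigidityProofs
import Literature.AnabelianGeometry.EtaleTheta.ThetaRigidityLevels

/-!
# [EtTh] §2 discharge: Corollary 2.19 (ii) from the NAMED level-wise facts of Cor 2.18 (iii), (iv)

Mochizuki, *The Étale Theta Function and its Frobenioid-theoretic Manifestations* [EtTh],
Publ. RIMS 45 (2009), §2, Cor 2.19 (ii) p.64, Cor 2.18 (iii)–(iv) pp.61–63 (locators `p.N` = PDF
pages of the PRIMS text; bib key `MochizukiEtTh2009`). PROOF-ONLY companion (no `def`; seat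
abc-iut-L2-d1, DAG node `EtTh:Cor2.19(ii)`): `ThetaEnvTower.cor219_ii_of` restated with its
hypotheses spelled as the `ThetaEnvData`-level named facts of `ThetaRigidityLevels.lean`
(seat abc-iut-L2-t2) at the levels `T.level M` of the tower. HONEST FRAMING: conditional discharge;
no side is taken on [IUTchIII] Cor 3.12; typed ≠ discharged elsewhere.
-/

namespace Literature.AnabelianGeometry.EtaleTheta

universe u

namespace ThetaEnvTower

variable {E : Set ℕ+} (T : ThetaEnvTower.{u} E)

/-- **Corollary 2.19 (ii) (Discrete Rigidity) — DISCHARGED modulo the named facts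
`Cor218_iii_PiX`, `Cor218_iii_quotient`, `Cor218_iv_surjective`, `Cor218_iv_fibre` (first clause) at
every level of the tower and `Cor218_iv_reduction`.** [cite: MochizukiEtTh2009, Cor 2.19(ii) p.64] -/
theorem cor219_ii_of_levels (hP : ∀ M : E, (T.level M).Cor218_iii_PiX)
    (hq : ∀ M : E, (T.level M).Cor218_iii_quotient)
    (hlift : ∀ M : E, (T.level M).Cor218_iv_surjective)
    (hfib : ∀ M : E, (T.level M).Cor218_iv_fibre) (hred : T.Cor218_iv_reduction) :
    T.Cor219_ii :=
  T.cor219_ii_of (hP ⟨1, T.one_mem⟩) hq (fun M η hη γ hγ => hlift M η hη γ hγ)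
    (fun M η hη => (hfib M η hη).1) hred

/-- **Corollary 2.19 (ii) — DISCHARGED modulo temp-slimness of `Π^tp_X` ([SemiAnbd] Ex. 3.10) and
the named facts `Cor218_iv_surjective`, `Cor218_iv_fibre` (first clause), `Cor218_iv_reduction`.**
[cite: MochizukiEtTh2009, Cor 2.19(ii) p.64] -/
theorem cor219_ii_of_levels_tempSlim
    (hts : ∀ U : Subgroup T.PiX, IsOpen (U : Set T.PiX) →
      ∀ z : T.PiX, (∀ u ∈ U, z * u = u * z) → z = 1)
    (hlift : ∀ M : E, (T.level M).Cor218_iv_surjective)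
    (hfib : ∀ M : E, (T.level M).Cor218_iv_fibre) (hred : T.Cor218_iv_reduction) :
    T.Cor219_ii :=
  T.cor219_ii_of (T.cor218_iii_of_tempSlim hts).1 (T.cor218_iii_of_tempSlim hts).2
    (fun M η hη γ hγ => hlift M η hη γ hγ) (fun M η hη => (hfib M η hη).1) hred

end ThetaEnvTower

end Literature.AnabelianGeometry.EtaleTheta
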